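import Mathlib.Geometry.Manifold.MFDeriv.FDeriv
import Mathlib.Geometry.Manifold.MFDeriv.Atlas
import Mathlib.Geometry.Manifold.ContMDiffMFDeriv
import Mathlib.Geometry.Manifold.VectorBundle.Tangent
import HarnessLib

/-!
# The differential of a function read in a non-preferred chart (boundary points allowed)

Topic `Literature/Topology/FourManifolds` (infrastructure for the compact collar theorem, fact
seat `provefact-Literature.SPC4.exists_diffeomorph_comp_incl_eq`: boundary-defining functions
(`BoundaryDefiningFunction.lean`) and the flow-out from the boundary (`BoundaryFlowout.lean`,
planned) read `df` in a fixed boundary chart rather than in the preferred chart at each point).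

Mathlib defines `mfderiv I 𝓘(ℝ, F) f z` through the *preferred* extended chart at `z`
(`writtenInExtChartAt`), as a derivative within `range I`.  For a function `f : M → F` into a
vector space and another chart `extChartAt I y` containing `z`, the chain rule *within*
`range I` (Mathlib's `hasFDerivWithinAt_tangentCoordChange` for the transition map, no interior
hypothesis) gives

* `Literature.Topology.FourManifolds.mfderiv_eq_fderivWithin_comp_tangentCoordChange`:
  `mfderiv f z = D (f ∘ (extChartAt I y).symm)|_{range I} (extChartAt I y z) ∘ tangentCoordChange I z y z`;
* `Literature.Topology.FourManifolds.mfderiv_tangentCoordChange_apply`, `Literature.Topology.FourManifolds.mfderiv_ne_zero_iff` — `df_z` on the vector with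
  coordinates `w` in the chart at `y`; `df_z ≠ 0` iff the chart derivative is nonzero;
* `Literature.Topology.FourManifolds.isOpen_setOf_mfderiv_ne_zero` — the regular set of a smooth `f : M → F` is open
  (continuity of `fderivWithin` on the chart target, `ContDiffOn.continuousOn_fderivWithin`);
* `Literature.Topology.FourManifolds.exists_pos_forall_mfderiv_ne_zero` — on a compact manifold a smooth `f ≥ 0` regular on
  `{f = 0}` is regular on some `{f < δ}`, `δ > 0`.

Everything is proved; all manifolds may have boundary or corners (`IsManifold I ∞ M` over any
real model with corners).

## References

* J. M. Lee, *Introduction to Smooth Manifolds*, 2nd ed., GTM 218 (2013), Ch. 3 (differentials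
  in coordinates, (3.9)–(3.10)) and Prop. 3.18 (change of coordinates). [LeeSmoothManifolds2013]
-/

open scoped Manifold ContDiff Topology
open Set Function

noncomputable section

namespace Literature.Topology.FourManifolds

/-! ### Derivatives read in a non-preferred chart -/

section ChartFormula

variable {E : Type*} [NormedAddCommGroup E] [NormedSpace ℝ E] {H : Type*} [TopologicalSpace H]
  {I : ModelWithCorners ℝ E H} {M : Type*} [TopologicalSpace M] [ChartedSpace H M]
  [IsManifold I ∞ M] {F : Type*} [NormedAddCommGroup F] [NormedSpace ℝ F]

/-- A function into a vector space which is differentiable at `z` (in the manifold sense) is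
differentiable within `range I` at the image of `z` in *any* chart `extChartAt I y` containing
`z`, as the composite `f ∘ (extChartAt I y).symm`. [folklore] -/
theorem differentiableWithinAt_comp_extChartAt_symm {f : M → F} {y z : M}
    (hz : z ∈ (chartAt H y).source) (hf : MDifferentiableAt I 𝓘(ℝ, F) f z) :
    DifferentiableWithinAt ℝ (f ∘ (extChartAt I y).symm) (range I) (extChartAt I y z) := by
  have h := (mdifferentiableAt_iff_of_mem_source (I' := 𝓘(ℝ, F)) (y := f z) hz
    (by simp)).1 hf
  simpa using h.2

/-- **The differential in a non-preferred chart.**  For `f : M → F` differentiable at `z` and a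
chart `extChartAt I y` containing `z`, the differential `mfderiv f z` (which Mathlib defines
through the preferred chart at `z`) is the derivative of `f ∘ (extChartAt I y).symm` within
`range I` at `extChartAt I y z`, precomposed with the coordinate change
`tangentCoordChange I z y z` from the chart at `z` to the chart at `y` (chain rule within
`range I`; no interior hypothesis). [folklore] -/
theorem mfderiv_eq_fderivWithin_comp_tangentCoordChange {f : M → F} {y z : M}
    (hz : z ∈ (chartAt H y).source) (hf : MDifferentiableAt I 𝓘(ℝ, F) f z) :
    mfderiv I 𝓘(ℝ, F) f z =
      (fderivWithin ℝ (f ∘ (extChartAt I y).symm) (range I) (extChartAt I y z)).comp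
        (tangentCoordChange I z y z) := by
  have hzy : z ∈ (extChartAt I y).source := by rwa [extChartAt_source]
  have hzz : z ∈ (extChartAt I z).source := mem_extChartAt_source z
  -- the derivative through the preferred chart
  have h1 : HasFDerivWithinAt (f ∘ (extChartAt I z).symm) (mfderiv I 𝓘(ℝ, F) f z) (range I)
      (extChartAt I z z) := by
    have h := hf.hasMFDerivAt.2
    simpa [writtenInExtChartAt] using h
  -- the derivative through the chart at `y`, by the chain rule within `range I`
  set D := fderivWithin ℝ (f ∘ (extChartAt I y).symm) (range I) (extChartAt I y z) with hD
  have h2 : HasFDerivWithinAt (f ∘ (extChartAt I y).symm) D (range I) (extChartAt I y z) :=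
    (differentiableWithinAt_comp_extChartAt_symm hz hf).hasFDerivWithinAt
  have h3 : HasFDerivWithinAt ((extChartAt I y) ∘ (extChartAt I z).symm)
      (tangentCoordChange I z y z) (range I) (extChartAt I z z) :=
    hasFDerivWithinAt_tangentCoordChange ⟨hzz, hzy⟩
  have hzyz : ((extChartAt I y) ∘ (extChartAt I z).symm) (extChartAt I z z) = extChartAt I y z := by
    simp
  rw [← hzyz] at h2
  have h4 : HasFDerivWithinAt ((f ∘ (extChartAt I y).symm) ∘ ((extChartAt I y) ∘ (extChartAt I z).symm))
      (D.comp (tangentCoordChange I z y z)) (range I) (extChartAt I z z) :=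
    h2.comp (extChartAt I z z) h3 fun q _ => by
      simp only [comp_apply, extChartAt_coe]
      exact mem_range_self _
  -- the two composites agree near `extChartAt I z z` within `range I`
  have hnhds : {q : E | (extChartAt I z).symm q ∈ (extChartAt I y).source} ∈ 𝓝 (extChartAt I z z) := by
    apply (continuousAt_extChartAt_symm z).preimage_mem_nhds
    rw [extChartAt_to_inv]
    exact (isOpen_extChartAt_source y).mem_nhds hzy
  have h5 : (f ∘ (extChartAt I z).symm) =ᶠ[𝓝[range I] (extChartAt I z z)]
      ((f ∘ (extChartAt I y).symm) ∘ ((extChartAt I y) ∘ (extChartAt I z).symm)) := by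
    filter_upwards [mem_nhdsWithin_of_mem_nhds hnhds] with q hq
    simp only [comp_apply, (extChartAt I y).left_inv hq]
  have h6 : HasFDerivWithinAt (f ∘ (extChartAt I z).symm) (D.comp (tangentCoordChange I z y z))
      (range I) (extChartAt I z z) :=
    h4.congr_of_eventuallyEq h5 (by simp [comp_apply, (chartAt H y).left_inv hz])
  haveI : T2Space (TangentSpace 𝓘(ℝ, F) (f z)) := inferInstanceAs (T2Space F)
  exact (I.uniqueDiffOn _ (mem_range_self _)).eq h1 h6

/-- The coordinate changes of the tangent bundle at a point are mutually inverse. [folklore] -/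
theorem tangentCoordChange_tangentCoordChange {y z : M} (hz : z ∈ (chartAt H y).source) (w : E) :
    tangentCoordChange I z y z (tangentCoordChange I y z z w) = w := by
  have hzy : z ∈ (extChartAt I y).source := by rwa [extChartAt_source]
  have hzz : z ∈ (extChartAt I z).source := mem_extChartAt_source z
  rw [tangentCoordChange_comp ⟨⟨hzy, hzz⟩, hzy⟩, tangentCoordChange_self hzy]

/-- **The differential in a non-preferred chart, applied**: `df_z` evaluated on the tangent
vector whose coordinates in the chart at `y` are `w` is the derivative of
`f ∘ (extChartAt I y).symm` within `range I` applied to `w`. [folklore] -/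
theorem mfderiv_tangentCoordChange_apply {f : M → F} {y z : M}
    (hz : z ∈ (chartAt H y).source) (hf : MDifferentiableAt I 𝓘(ℝ, F) f z) (w : E) :
    mfderiv I 𝓘(ℝ, F) f z (tangentCoordChange I y z z w) =
      fderivWithin ℝ (f ∘ (extChartAt I y).symm) (range I) (extChartAt I y z) w := by
  rw [mfderiv_eq_fderivWithin_comp_tangentCoordChange hz hf]
  show fderivWithin ℝ (f ∘ (extChartAt I y).symm) (range I) (extChartAt I y z)
    (tangentCoordChange I z y z (tangentCoordChange I y z z w)) = _
  rw [tangentCoordChange_tangentCoordChange hz]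

/-- `df_z ≠ 0` iff the derivative of `f ∘ (extChartAt I y).symm` within `range I` at
`extChartAt I y z` is nonzero, for any chart `y` containing `z`. [folklore] -/
theorem mfderiv_ne_zero_iff {f : M → F} {y z : M}
    (hz : z ∈ (chartAt H y).source) (hf : MDifferentiableAt I 𝓘(ℝ, F) f z) :
    mfderiv I 𝓘(ℝ, F) f z ≠ 0 ↔
      fderivWithin ℝ (f ∘ (extChartAt I y).symm) (range I) (extChartAt I y z) ≠ 0 := by
  rw [not_iff_not]
  constructor
  · intro h
    ext w
    rw [← mfderiv_tangentCoordChange_apply hz hf, h]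
    rfl
  · intro h
    rw [mfderiv_eq_fderivWithin_comp_tangentCoordChange hz hf, h, ContinuousLinearMap.zero_comp]
    rfl

omit [IsManifold I ∞ M] in
/-- On a chart source, the derivative of `f ∘ (extChartAt I y).symm` within the chart target
agrees with the derivative within `range I`. [folklore] -/
theorem fderivWithin_extChartAt_target_eq {f : M → F} {y : M} {q : E}
    (hq : q ∈ (extChartAt I y).target) :
    fderivWithin ℝ (f ∘ (extChartAt I y).symm) (extChartAt I y).target q =
      fderivWithin ℝ (f ∘ (extChartAt I y).symm) (range I) q := by
  rw [extChartAt_target] at hq ⊢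
  rw [inter_comm]
  exact fderivWithin_inter ((I.continuous_symm.isOpen_preimage _ (chartAt H y).open_target).mem_nhds
    hq.1)

/-- **The set of regular points of a smooth function into a vector space is open.**  Read in
a fixed chart `y` near `z₀`, `df_z ≠ 0` iff the derivative of `f ∘ (extChartAt I y).symm` within
the chart target is nonzero at `extChartAt I y z`, and that derivative is continuous on the
target (`ContDiffOn.continuousOn_fderivWithin`). [folklore] -/
theorem isOpen_setOf_mfderiv_ne_zero {f : M → F} (hf : ContMDiff I 𝓘(ℝ, F) ∞ f) :
    IsOpen {z : M | mfderiv I 𝓘(ℝ, F) f z ≠ 0} := by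
  rw [isOpen_iff_mem_nhds]
  intro z₀ hz₀
  set y := z₀
  set G : E → E →L[ℝ] F := fderivWithin ℝ (f ∘ (extChartAt I y).symm) (extChartAt I y).target
  have hF : ContDiffOn ℝ ∞ (f ∘ (extChartAt I y).symm) (extChartAt I y).target :=
    (hf.comp_contMDiffOn (contMDiffOn_extChartAt_symm y)).contDiffOn
  have hG : ContinuousOn G (extChartAt I y).target :=
    hF.continuousOn_fderivWithin (uniqueDiffOn_extChartAt_target y) (by simp)
  have hGe : ContinuousOn (fun z => G (extChartAt I y z)) (extChartAt I y).source :=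
    hG.comp (continuousOn_extChartAt (I := I) y) fun z hz => (extChartAt I y).map_source hz
  have hopen : IsOpen ((extChartAt I y).source ∩ (fun z => G (extChartAt I y z)) ⁻¹' {L | L ≠ 0}) :=
    hGe.isOpen_inter_preimage (isOpen_extChartAt_source y) isOpen_ne
  have hiff : ∀ z ∈ (extChartAt I y).source,
      (mfderiv I 𝓘(ℝ, F) f z ≠ 0 ↔ G (extChartAt I y z) ≠ 0) := by
    intro z hz
    have hz' : z ∈ (chartAt H y).source := by rwa [extChartAt_source] at hz
    rw [mfderiv_ne_zero_iff hz' (hf.mdifferentiableAt (by simp)),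
      ← fderivWithin_extChartAt_target_eq ((extChartAt I y).map_source hz)]
  refine Filter.mem_of_superset (hopen.mem_nhds ⟨mem_extChartAt_source z₀, ?_⟩) ?_
  · exact (hiff z₀ (mem_extChartAt_source z₀)).1 hz₀
  · rintro z ⟨hz, hGz⟩
    exact (hiff z hz).2 hGz

/-- On a compact manifold, a smooth nonnegative function which is regular on its zero set is
regular on a whole sublevel set `{f < δ}`, `δ > 0`. [folklore] -/
theorem exists_pos_forall_mfderiv_ne_zero [CompactSpace M] {f : M → ℝ}
    (hf : ContMDiff I 𝓘(ℝ, ℝ) ∞ f) (h0 : ∀ z, 0 ≤ f z)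
    (hreg : ∀ z, f z = 0 → mfderiv I 𝓘(ℝ, ℝ) f z ≠ 0) :
    ∃ δ > 0, ∀ z, f z < δ → mfderiv I 𝓘(ℝ, ℝ) f z ≠ 0 := by
  set K := {z : M | mfderiv I 𝓘(ℝ, ℝ) f z ≠ 0}ᶜ with hK
  have hKc : IsCompact K := (isOpen_setOf_mfderiv_ne_zero hf).isClosed_compl.isCompact
  rcases K.eq_empty_or_nonempty with hKe | hKne
  · refine ⟨1, one_pos, fun z _ => ?_⟩
    have : z ∉ K := by rw [hKe]; exact notMem_empty z
    simpa [hK] using this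
  · obtain ⟨z₁, hz₁K, hmin⟩ := hKc.exists_isMinOn hKne hf.continuous.continuousOn
    have hz₁ : 0 < f z₁ := by
      rcases (h0 z₁).lt_or_eq with h | h
      · exact h
      · exfalso
        have h1 : mfderiv I 𝓘(ℝ, ℝ) f z₁ ≠ 0 := hreg z₁ h.symm
        exact hz₁K h1
    refine ⟨f z₁, hz₁, fun z hz hcrit => ?_⟩
    have hzK : z ∈ K := by simpa [hK] using hcrit
    exact absurd (hmin hzK) (not_le.2 hz)

end ChartFormula

end Literature.Topology.FourManifolds
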